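import Mathlib.Analysis.SpecialFunctions.Integrals.Basic
import Mathlib.MeasureTheory.Integral.IntervalIntegral.FundThmCalculus
import Mathlib.Analysis.SpecialFunctions.Trigonometric.Deriv
import Mathlib.Analysis.SpecialFunctions.ExpDeriv
import HarnessLib

/-!
# The one-plaquette Schwinger–Dyson identity `⟨cos θ⟩_β = β ⟨sin² θ⟩_β` — the exact value behind a reference-free `V1` test

HONEST FRAMING: exact (Metropolis-corrected) sampling algorithms for lattice gauge theory;
figures of merit are autocorrelation/cost numbers at stated couplings and volumes; no
continuum-physics claim.

Venture `LatticeQCDFlow` (cell pub-lqcd), sub-topic `Scoring`; FANOUT row 11 (`eng-scorerA`,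
fitness scorer A).  NEW WORK of the cell in the sense of the placement rule (one integration by parts
on the circle, our own proof); the general statement is the lattice Schwinger–Dyson /
Makeenko–Migdal loop equation (per-link Haar invariance of the Wilson measure), named here, not
cited as a tree fact.

## Why the scorer cares (LEADERBOARD-2 docket L2-A15)

In four dimensions the frozen scorer pair can reject the planted class X-2 ('log-det dropped': an
exact sampler of the WRONG density) only through a literature plaquette at one of eleven table
keys; elsewhere X-2 reads VALID-by-absence (row 11's read of eng-equiv's 4-d SU(2) example,
2026-08-21).  Row 10 (eng-equiv) offered a reference-FREE handle: the Schwinger–Dyson residual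
`R_{l,P₀}` of a link and a plaquette through it, whose expectation vanishes EXACTLY under
`e^{−S_W} dU` at every coupling, volume, dimension and boundary condition; for U(1) it reads
`R = cos θ_{P₀} − β Σ_{P ∋ l} sin θ_P sin θ_{P₀}`.  The candidate scorer change (docket L2-A15 (b))
is a key-free identity test `⟨R⟩ = 0`, of the same code shape as today's `⟨e^{−ΔH}⟩ = 1`.

This file kernel-checks the identity in its smallest instance — ONE plaquette angle `θ` with
density `∝ e^{β cos θ}` on `[0, 2π]` (2-d U(1), a single plaquette; the sum over `P ∋ l` has the
single term `P₀`), which is also the normalisation anchor an implementation of `R` is unit-tested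
against:

* `hasDerivAt_sin_mul_exp_cos` — `d/dθ [sin θ · e^{β cos θ}] = (cos θ − β sin² θ) e^{β cos θ}`;
* **`integral_sdResidual_onePlaquette`** — `∫_0^{2π} (cos θ − β sin² θ) e^{β cos θ} dθ = 0` for every
  real `β` (fundamental theorem of calculus; the boundary term is `sin 2π · e^{β} − sin 0 · e^{β} = 0`);
* `onePlaquetteZ_pos` — the partition function `Z(β) = ∫_0^{2π} e^{β cos θ} dθ > 0`;
* **`expect_cos_eq_beta_mul_expect_sin_sq`** — hence `⟨cos θ⟩_β = β ⟨sin² θ⟩_β` with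
  `⟨f⟩_β = (1/Z) ∫_0^{2π} f(θ) e^{β cos θ} dθ`: the U(1) one-plaquette Schwinger–Dyson identity (in
  Bessel language `I₁(β)/I₀(β) = (β/2)(1 − I₂(β)/I₀(β))`, i.e. `I₀ − I₂ = (2/β) I₁`).

What is NOT here: the multi-link / non-abelian statement (product Haar measure, `SU(N)` left
invariance) and any claim about the statistical POWER of an `⟨R⟩ = 0` test against X-1 / X-2 —
that is row 10's canary to measure.
-/

namespace Summit.Ventures.LatticeQCDFlow.Scoring

open Real MeasureTheory intervalIntegral Set

/-- The one-plaquette Schwinger–Dyson residual density: `(cos θ − β sin² θ) · e^{β cos θ}`. -/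
noncomputable def sdResidualDensity (β θ : ℝ) : ℝ :=
  (Real.cos θ - β * Real.sin θ ^ 2) * Real.exp (β * Real.cos θ)

/-- `d/dθ [sin θ · e^{β cos θ}] = (cos θ − β sin² θ) · e^{β cos θ}`. -/
theorem hasDerivAt_sin_mul_exp_cos (β θ : ℝ) :
    HasDerivAt (fun x => Real.sin x * Real.exp (β * Real.cos x)) (sdResidualDensity β θ) θ := by
  have h1 : HasDerivAt (fun x => β * Real.cos x) (β * (-Real.sin θ)) θ :=
    (Real.hasDerivAt_cos θ).const_mul β
  have h2 : HasDerivAt (fun x => Real.exp (β * Real.cos x))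
      (Real.exp (β * Real.cos θ) * (β * (-Real.sin θ))) θ := h1.exp
  have h3 : HasDerivAt (fun x => Real.sin x * Real.exp (β * Real.cos x))
      (Real.cos θ * Real.exp (β * Real.cos θ)
        + Real.sin θ * (Real.exp (β * Real.cos θ) * (β * -Real.sin θ))) θ :=
    (Real.hasDerivAt_sin θ).mul h2
  have heq : sdResidualDensity β θ = Real.cos θ * Real.exp (β * Real.cos θ)
      + Real.sin θ * (Real.exp (β * Real.cos θ) * (β * -Real.sin θ)) := by
    unfold sdResidualDensity; ring
  rw [heq]
  exact h3

/-- The residual density is continuous in `θ`. -/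
theorem continuous_sdResidualDensity (β : ℝ) : Continuous (sdResidualDensity β) := by
  unfold sdResidualDensity
  fun_prop

/-- **The one-plaquette Schwinger–Dyson identity (unnormalised).**  For every real `β`:
`∫_0^{2π} (cos θ − β sin² θ) e^{β cos θ} dθ = 0`. -/
theorem integral_sdResidual_onePlaquette (β : ℝ) :
    ∫ θ in (0 : ℝ)..(2 * π), sdResidualDensity β θ = 0 := by
  rw [integral_eq_sub_of_hasDerivAt (f := fun x => Real.sin x * Real.exp (β * Real.cos x))
    (fun θ _ => hasDerivAt_sin_mul_exp_cos β θ)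
    ((continuous_sdResidualDensity β).intervalIntegrable _ _)]
  simp [Real.sin_two_pi]

/-- The one-plaquette partition function `Z(β) = ∫_0^{2π} e^{β cos θ} dθ` (`= 2π I₀(β)`). -/
noncomputable def onePlaquetteZ (β : ℝ) : ℝ :=
  ∫ θ in (0 : ℝ)..(2 * π), Real.exp (β * Real.cos θ)

/-- `Z(β) > 0`. -/
theorem onePlaquetteZ_pos (β : ℝ) : 0 < onePlaquetteZ β := by
  unfold onePlaquetteZ
  refine intervalIntegral_pos_of_pos_on ?_ (fun x _ => Real.exp_pos _) (by positivity)
  exact (by fun_prop : Continuous fun θ => Real.exp (β * Real.cos θ)).intervalIntegrable _ _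

/-- The one-plaquette expectation `⟨f⟩_β = (1/Z) ∫_0^{2π} f(θ) e^{β cos θ} dθ`. -/
noncomputable def onePlaquetteExpect (β : ℝ) (f : ℝ → ℝ) : ℝ :=
  (∫ θ in (0 : ℝ)..(2 * π), f θ * Real.exp (β * Real.cos θ)) / onePlaquetteZ β

/-- **`⟨cos θ⟩_β = β ⟨sin² θ⟩_β`** — the U(1) one-plaquette Schwinger–Dyson identity, the exact value
(`0` for the residual `cos θ − β sin² θ`) a key-free `V1` identity test would compare against. -/
theorem expect_cos_eq_beta_mul_expect_sin_sq (β : ℝ) :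
    onePlaquetteExpect β Real.cos = β * onePlaquetteExpect β (fun θ => Real.sin θ ^ 2) := by
  have hc : IntervalIntegrable (fun θ => Real.cos θ * Real.exp (β * Real.cos θ)) volume 0 (2 * π) :=
    (by fun_prop : Continuous fun θ => Real.cos θ * Real.exp (β * Real.cos θ)).intervalIntegrable _ _
  have hs : IntervalIntegrable (fun θ => Real.sin θ ^ 2 * Real.exp (β * Real.cos θ)) volume 0 (2 * π) :=
    (by fun_prop : Continuous fun θ => Real.sin θ ^ 2 * Real.exp (β * Real.cos θ)).intervalIntegrable
      _ _
  have h0 := integral_sdResidual_onePlaquette β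
  have hsplit : ∫ θ in (0 : ℝ)..(2 * π), sdResidualDensity β θ
      = (∫ θ in (0 : ℝ)..(2 * π), Real.cos θ * Real.exp (β * Real.cos θ))
        - β * ∫ θ in (0 : ℝ)..(2 * π), Real.sin θ ^ 2 * Real.exp (β * Real.cos θ) := by
    have hpt : (fun θ => sdResidualDensity β θ)
        = fun θ => Real.cos θ * Real.exp (β * Real.cos θ)
            - β * (Real.sin θ ^ 2 * Real.exp (β * Real.cos θ)) := by
      funext θ; unfold sdResidualDensity; ring
    rw [hpt, intervalIntegral.integral_sub hc (hs.const_mul β), intervalIntegral.integral_const_mul]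
  rw [hsplit] at h0
  have h0' : ∫ θ in (0 : ℝ)..(2 * π), Real.cos θ * Real.exp (β * Real.cos θ)
      = β * ∫ θ in (0 : ℝ)..(2 * π), Real.sin θ ^ 2 * Real.exp (β * Real.cos θ) := by linarith
  unfold onePlaquetteExpect
  show (∫ θ in (0 : ℝ)..(2 * π), Real.cos θ * Real.exp (β * Real.cos θ)) / onePlaquetteZ β
      = β * ((∫ θ in (0 : ℝ)..(2 * π), Real.sin θ ^ 2 * Real.exp (β * Real.cos θ)) / onePlaquetteZ β)
  rw [h0', mul_div_assoc]

/-- Equivalently, the expectation of the residual itself vanishes: `⟨cos θ − β sin² θ⟩_β = 0`. -/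
theorem expect_sdResidual_eq_zero (β : ℝ) :
    onePlaquetteExpect β (fun θ => Real.cos θ - β * Real.sin θ ^ 2) = 0 := by
  unfold onePlaquetteExpect
  have h : (fun θ => (Real.cos θ - β * Real.sin θ ^ 2) * Real.exp (β * Real.cos θ))
      = sdResidualDensity β := by
    funext θ; rfl
  rw [h, integral_sdResidual_onePlaquette, zero_div]

/-! ### The SU(2) one-plaquette instance (appended 2026-08-21, GEN-11)

Row 10's non-abelian residual reads, for SU(2) (`C_F = 3/4`),
`R = ¾ tr Y + (β/8) Σ_{P∋l} [2 tr(X_P Y) − tr X_P · tr Y]`.  With ONE plaquette (`X_P = Y = U`,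
Wilson weight `e^{(β/2) tr U}`) and the class-function reduction of Haar measure on `SU(2)`
(`tr U = 2 cos α`, reduced density `∝ sin² α` on `[0, π]`; Cayley–Hamilton `tr U² = (tr U)² − 2`)
the residual becomes `R = ¾·2cos α + (β/8)(4cos²α − 4) = (3/2) cos α − (β/2) sin² α`, and
`⟨R⟩ = 0` is again ONE integration by parts:
`d/dα [sin³α · e^{β cos α}] = (3 cos α sin²α − β sin⁴α) e^{β cos α} = 2 sin²α · R(α) · e^{β cos α}`,
whose integral over `[0, π]` vanishes (`sin 0 = sin π = 0`).  This checks the CONSTANTS of the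
SU(2) formula (`3/4`, `β/8`, the `2 tr(X Y) − tr X tr Y` structure) in the one-plaquette case. -/

/-- The SU(2) one-plaquette residual density in the class angle `α` (`tr U = 2 cos α`), INCLUDING
the reduced Haar weight `sin² α`: `(3 cos α sin² α − β sin⁴ α) · e^{β cos α} = 2 sin²α · R(α) · e^{β cos α}`. -/
noncomputable def sdResidualDensitySU2 (β α : ℝ) : ℝ :=
  (3 * Real.cos α * Real.sin α ^ 2 - β * Real.sin α ^ 4) * Real.exp (β * Real.cos α)

/-- `d/dα [sin³ α · e^{β cos α}] = (3 cos α sin² α − β sin⁴ α) · e^{β cos α}`. -/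
theorem hasDerivAt_sin_cube_mul_exp_cos (β α : ℝ) :
    HasDerivAt (fun x => Real.sin x ^ 3 * Real.exp (β * Real.cos x)) (sdResidualDensitySU2 β α) α := by
  have h1 : HasDerivAt (fun x => β * Real.cos x) (β * (-Real.sin α)) α :=
    (Real.hasDerivAt_cos α).const_mul β
  have h2 : HasDerivAt (fun x => Real.exp (β * Real.cos x))
      (Real.exp (β * Real.cos α) * (β * (-Real.sin α))) α := h1.exp
  have h3a : HasDerivAt (fun x => Real.sin x * Real.sin x)
      (Real.cos α * Real.sin α + Real.sin α * Real.cos α) α :=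
    (Real.hasDerivAt_sin α).mul (Real.hasDerivAt_sin α)
  have h3b : HasDerivAt (fun x => Real.sin x * Real.sin x * Real.sin x)
      ((Real.cos α * Real.sin α + Real.sin α * Real.cos α) * Real.sin α
        + Real.sin α * Real.sin α * Real.cos α) α :=
    h3a.mul (Real.hasDerivAt_sin α)
  have hfun : (fun x => Real.sin x ^ 3) = fun x => Real.sin x * Real.sin x * Real.sin x := by
    funext x; ring
  have h3 : HasDerivAt (fun x => Real.sin x ^ 3) (3 * Real.sin α ^ 2 * Real.cos α) α := by
    rw [hfun]
    have heq3 : 3 * Real.sin α ^ 2 * Real.cos α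
        = (Real.cos α * Real.sin α + Real.sin α * Real.cos α) * Real.sin α
          + Real.sin α * Real.sin α * Real.cos α := by ring
    rw [heq3]
    exact h3b
  have h4 : HasDerivAt (fun x => Real.sin x ^ 3 * Real.exp (β * Real.cos x))
      (3 * Real.sin α ^ 2 * Real.cos α * Real.exp (β * Real.cos α)
        + Real.sin α ^ 3 * (Real.exp (β * Real.cos α) * (β * -Real.sin α))) α := h3.mul h2
  have heq : sdResidualDensitySU2 β α
      = 3 * Real.sin α ^ 2 * Real.cos α * Real.exp (β * Real.cos α)
        + Real.sin α ^ 3 * (Real.exp (β * Real.cos α) * (β * -Real.sin α)) := by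
    unfold sdResidualDensitySU2; ring
  rw [heq]
  exact h4

/-- The SU(2) residual density is continuous in `α`. -/
theorem continuous_sdResidualDensitySU2 (β : ℝ) : Continuous (sdResidualDensitySU2 β) := by
  unfold sdResidualDensitySU2
  fun_prop

/-- **The SU(2) one-plaquette Schwinger–Dyson identity (unnormalised, class-angle form).**  For
every real `β`: `∫_0^{π} (3 cos α sin² α − β sin⁴ α) e^{β cos α} dα = 0`. -/
theorem integral_sdResidual_onePlaquette_su2 (β : ℝ) :
    ∫ α in (0 : ℝ)..π, sdResidualDensitySU2 β α = 0 := by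
  rw [integral_eq_sub_of_hasDerivAt (f := fun x => Real.sin x ^ 3 * Real.exp (β * Real.cos x))
    (fun α _ => hasDerivAt_sin_cube_mul_exp_cos β α)
    ((continuous_sdResidualDensitySU2 β).intervalIntegrable _ _)]
  simp [Real.sin_pi]

/-- The SU(2) one-plaquette partition function in the class angle,
`Z₂(β) = ∫_0^{π} sin² α · e^{β cos α} dα` (`= (π/β) I₁(β)`; the `2/π` Haar normalisation cancels in
expectations). -/
noncomputable def onePlaquetteZSU2 (β : ℝ) : ℝ :=
  ∫ α in (0 : ℝ)..π, Real.sin α ^ 2 * Real.exp (β * Real.cos α)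

/-- `Z₂(β) > 0` (`sin² α > 0` on the open interval). -/
theorem onePlaquetteZSU2_pos (β : ℝ) : 0 < onePlaquetteZSU2 β := by
  unfold onePlaquetteZSU2
  refine intervalIntegral_pos_of_pos_on ?_ (fun x hx => ?_) Real.pi_pos
  · exact (by fun_prop : Continuous fun α => Real.sin α ^ 2 * Real.exp (β * Real.cos α)).intervalIntegrable
      _ _
  · have hs : 0 < Real.sin x := Real.sin_pos_of_pos_of_lt_pi hx.1 hx.2
    positivity

/-- The SU(2) one-plaquette expectation of a class function of the angle,
`⟨f⟩ = (1/Z₂) ∫_0^{π} f(α) sin² α e^{β cos α} dα`. -/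
noncomputable def onePlaquetteExpectSU2 (β : ℝ) (f : ℝ → ℝ) : ℝ :=
  (∫ α in (0 : ℝ)..π, f α * (Real.sin α ^ 2 * Real.exp (β * Real.cos α))) / onePlaquetteZSU2 β

/-- **`3 ⟨cos α⟩ = β ⟨sin² α⟩` under the SU(2) one-plaquette weight** — equivalently
`⟨¾ tr U⟩ = −(β/8) ⟨2 tr U² − (tr U)²⟩ = (β/2) ⟨sin² α⟩` with `tr U = 2 cos α`: row 10's SU(2)
residual has expectation zero in the one-plaquette case. -/
theorem three_mul_expect_cos_eq_beta_mul_expect_sin_sq_su2 (β : ℝ) :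
    3 * onePlaquetteExpectSU2 β Real.cos = β * onePlaquetteExpectSU2 β (fun α => Real.sin α ^ 2) := by
  have hc : IntervalIntegrable (fun α => Real.cos α * (Real.sin α ^ 2 * Real.exp (β * Real.cos α)))
      volume 0 π :=
    (by fun_prop : Continuous fun α => Real.cos α * (Real.sin α ^ 2 * Real.exp (β * Real.cos α))).intervalIntegrable
      _ _
  have hs : IntervalIntegrable (fun α => Real.sin α ^ 2 * (Real.sin α ^ 2 * Real.exp (β * Real.cos α)))
      volume 0 π :=
    (by fun_prop : Continuous fun α => Real.sin α ^ 2 * (Real.sin α ^ 2 * Real.exp (β * Real.cos α))).intervalIntegrable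
      _ _
  have h0 := integral_sdResidual_onePlaquette_su2 β
  have hpt : (fun α => sdResidualDensitySU2 β α)
      = fun α => 3 * (Real.cos α * (Real.sin α ^ 2 * Real.exp (β * Real.cos α)))
          - β * (Real.sin α ^ 2 * (Real.sin α ^ 2 * Real.exp (β * Real.cos α))) := by
    funext α; unfold sdResidualDensitySU2; ring
  rw [hpt, intervalIntegral.integral_sub (hc.const_mul 3) (hs.const_mul β),
    intervalIntegral.integral_const_mul, intervalIntegral.integral_const_mul] at h0
  have h0' : 3 * ∫ α in (0 : ℝ)..π, Real.cos α * (Real.sin α ^ 2 * Real.exp (β * Real.cos α))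
      = β * ∫ α in (0 : ℝ)..π, Real.sin α ^ 2 * (Real.sin α ^ 2 * Real.exp (β * Real.cos α)) := by
    linarith
  unfold onePlaquetteExpectSU2
  show 3 * ((∫ α in (0 : ℝ)..π, Real.cos α * (Real.sin α ^ 2 * Real.exp (β * Real.cos α)))
      / onePlaquetteZSU2 β)
      = β * ((∫ α in (0 : ℝ)..π, Real.sin α ^ 2 * (Real.sin α ^ 2 * Real.exp (β * Real.cos α)))
        / onePlaquetteZSU2 β)
  rw [← mul_div_assoc, ← mul_div_assoc, h0']

/-- The residual form: `⟨(3/2) cos α − (β/2) sin² α⟩ = 0`, i.e. `⟨R⟩ = 0` for row 10's SU(2)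
residual `R = ¾ tr U + (β/8)(2 tr U² − (tr U)²)` on one plaquette (`tr U = 2 cos α`,
`tr U² = 4 cos²α − 2`). -/
theorem expect_sdResidualSU2_eq_zero (β : ℝ) :
    onePlaquetteExpectSU2 β (fun α => 3 / 2 * Real.cos α - β / 2 * Real.sin α ^ 2) = 0 := by
  unfold onePlaquetteExpectSU2
  have h : (fun α => (3 / 2 * Real.cos α - β / 2 * Real.sin α ^ 2)
        * (Real.sin α ^ 2 * Real.exp (β * Real.cos α)))
      = fun α => (1 / 2 : ℝ) * sdResidualDensitySU2 β α := by
    funext α; unfold sdResidualDensitySU2; ring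
  rw [h, intervalIntegral.integral_const_mul, integral_sdResidual_onePlaquette_su2, mul_zero, zero_div]

/-- The trace-variable bookkeeping: with `t = tr U = 2 cos α`, Cayley–Hamilton for SU(2) gives
`tr U² = t² − 2`, and row 10's one-plaquette SU(2) residual `¾ t + (β/8)(2 (t² − 2) − t²)` equals
`(3/2) cos α − (β/2) sin² α`. -/
theorem sdResidualSU2_trace_form (β α : ℝ) :
    3 / 4 * (2 * Real.cos α) + β / 8 * (2 * ((2 * Real.cos α) ^ 2 - 2) - (2 * Real.cos α) ^ 2)
      = 3 / 2 * Real.cos α - β / 2 * Real.sin α ^ 2 := by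
  have h : Real.sin α ^ 2 = 1 - Real.cos α ^ 2 := by
    have := Real.sin_sq_add_cos_sq α
    linarith
  rw [h]
  ring

/-! ### Haar values (the β-weight switched off): what an UNCORRECTED proposal stream prints
(appended 2026-08-21, GEN-11)

Row 10's canary (equiv 0.4.0-stage1, kit j132983) evaluates `R` on Haar-distributed configurations —
the law of an untrained flow's proposals with the accept step OFF (the X-1 class) — and quotes the
closed forms `⟨R⟩_Haar = −β/2` (U(1)) and `−3β/8` (SU(2)); measured −0.5038 ± 0.0047 at β = 1 and
−0.7438 ± 0.0036 at β = 2.  In the one-plaquette reduction these are two elementary integrals. -/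

/-- `∫_0^{2π} (cos θ − β sin² θ) dθ = −β π`. -/
theorem integral_sdResidualU1_haar (β : ℝ) :
    ∫ θ in (0 : ℝ)..(2 * π), (Real.cos θ - β * Real.sin θ ^ 2) = -(β * π) := by
  have hc : IntervalIntegrable (fun θ => Real.cos θ) volume 0 (2 * π) :=
    Real.continuous_cos.intervalIntegrable _ _
  have hs : IntervalIntegrable (fun θ => Real.sin θ ^ 2) volume 0 (2 * π) :=
    (by fun_prop : Continuous fun θ => Real.sin θ ^ 2).intervalIntegrable _ _
  rw [intervalIntegral.integral_sub hc (hs.const_mul β), intervalIntegral.integral_const_mul,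
    integral_cos, integral_sin_sq]
  simp [Real.sin_two_pi, Real.cos_two_pi]

/-- **U(1) Haar value:** the uniform (`β`-weight off) mean of the one-plaquette residual is
`(1/2π) ∫_0^{2π} (cos θ − β sin² θ) dθ = −β/2` — row 10's closed form for the uncorrected U(1)
stream (canary: −0.5038 ± 0.0047 at β = 1). -/
theorem haarMean_sdResidualU1 (β : ℝ) :
    (∫ θ in (0 : ℝ)..(2 * π), (Real.cos θ - β * Real.sin θ ^ 2)) / (2 * π) = -(β / 2) := by
  rw [integral_sdResidualU1_haar]
  have hπ : (π : ℝ) ≠ 0 := Real.pi_ne_zero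
  field_simp

/-- `∫_0^{π} sin² α dα = π/2` (the reduced SU(2) Haar normalisation, up to `2/π`). -/
theorem integral_sin_sq_zero_pi : ∫ α in (0 : ℝ)..π, Real.sin α ^ 2 = π / 2 := by
  rw [integral_sin_sq]
  simp

/-- `∫_0^{π} sin⁴ α dα = 3π/8`. -/
theorem integral_sin_pow_four_zero_pi : ∫ α in (0 : ℝ)..π, Real.sin α ^ 4 = 3 * π / 8 := by
  have h := integral_sin_pow (a := (0 : ℝ)) (b := π) 2
  rw [show (2 : ℕ) + 2 = 4 from rfl] at h
  rw [h, integral_sin_sq_zero_pi]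
  simp
  ring

/-- `∫_0^{π} cos α sin² α dα = 0` (`= [sin³ α / 3]_0^{π}`). -/
theorem integral_cos_mul_sin_sq_zero_pi : ∫ α in (0 : ℝ)..π, Real.cos α * Real.sin α ^ 2 = 0 := by
  have hd : ∀ x ∈ Set.uIcc (0 : ℝ) π,
      HasDerivAt (fun y => Real.sin y ^ 3 / 3) (Real.cos x * Real.sin x ^ 2) x := by
    intro x _
    have h3a : HasDerivAt (fun y => Real.sin y * Real.sin y)
        (Real.cos x * Real.sin x + Real.sin x * Real.cos x) x :=
      (Real.hasDerivAt_sin x).mul (Real.hasDerivAt_sin x)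
    have h3b : HasDerivAt (fun y => Real.sin y * Real.sin y * Real.sin y)
        ((Real.cos x * Real.sin x + Real.sin x * Real.cos x) * Real.sin x
          + Real.sin x * Real.sin x * Real.cos x) x :=
      h3a.mul (Real.hasDerivAt_sin x)
    have h3c := h3b.div_const 3
    have hfun : (fun y => Real.sin y ^ 3 / 3) = fun y => Real.sin y * Real.sin y * Real.sin y / 3 := by
      funext y; ring
    have hval : Real.cos x * Real.sin x ^ 2
        = ((Real.cos x * Real.sin x + Real.sin x * Real.cos x) * Real.sin x
          + Real.sin x * Real.sin x * Real.cos x) / 3 := by ring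
    rw [hfun, hval]
    exact h3c
  rw [integral_eq_sub_of_hasDerivAt hd
    ((by fun_prop : Continuous fun α => Real.cos α * Real.sin α ^ 2).intervalIntegrable _ _)]
  simp [Real.sin_pi]

/-- **SU(2) Haar value:** the reduced-Haar (`(2/π) sin² α dα`, β-weight off) mean of the
one-plaquette SU(2) residual `(3/2) cos α − (β/2) sin² α` is `−3β/8` — row 10's closed form for the
uncorrected SU(2) stream (canary: −0.7438 ± 0.0036 at β = 2, i.e. −0.75). -/
theorem haarMean_sdResidualSU2 (β : ℝ) :
    (∫ α in (0 : ℝ)..π, (3 / 2 * Real.cos α - β / 2 * Real.sin α ^ 2) * Real.sin α ^ 2)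
      / (∫ α in (0 : ℝ)..π, Real.sin α ^ 2) = -(3 * β / 8) := by
  have hc : IntervalIntegrable (fun α => Real.cos α * Real.sin α ^ 2) volume 0 π :=
    (by fun_prop : Continuous fun α => Real.cos α * Real.sin α ^ 2).intervalIntegrable _ _
  have hs : IntervalIntegrable (fun α => Real.sin α ^ 4) volume 0 π :=
    (by fun_prop : Continuous fun α => Real.sin α ^ 4).intervalIntegrable _ _
  have hsplit : (fun α => (3 / 2 * Real.cos α - β / 2 * Real.sin α ^ 2) * Real.sin α ^ 2)
      = fun α => 3 / 2 * (Real.cos α * Real.sin α ^ 2) - β / 2 * Real.sin α ^ 4 := by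
    funext α; ring
  rw [hsplit, intervalIntegral.integral_sub (hc.const_mul _) (hs.const_mul _),
    intervalIntegral.integral_const_mul, intervalIntegral.integral_const_mul,
    integral_cos_mul_sin_sq_zero_pi, integral_sin_pow_four_zero_pi, integral_sin_sq_zero_pi]
  have hπ : (π : ℝ) ≠ 0 := Real.pi_ne_zero
  field_simp
  ring

end Summit.Ventures.LatticeQCDFlow.Scoring
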